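/-
Copyright: the b2b-balaban T⁴-continuum CRUX team, row NE7b, leaf prover `t4-ne7b-formalise-leaf-01` (gen 80); junction of its
`CompactFibreRelative` with the OWNER lineage `t4-ne7b-p1` (gen 105)'s `CarrierOnSupport`. Project licence.
-/
import Summits.QuantumFields.BalabanUV.T4Continuum.Spine.NE7b.CompactFibreRelative
import Summits.QuantumFields.BalabanUV.T4Continuum.Spine.NE7b.CarrierOnSupport

/-!
# `LocCondStability` BY NAME for the FIBREWISE-RELATIVE compact-fibre carrier: `M = (∫F·w·e^{−I}) ∕ (∫G·w·e^{−I})` with positivity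
# RELATIVE to a fibrewise level raised by a large-field FLOOR `a`, a centred Haar window of mass `κ(W)` and a relative excess `i₀`
# inhabits the road's named `Prop` with `b = i₀ − a + b_vol` — the floor is SUBTRACTED (row NE7b, node U5c; kernel junction — the
# relative companion of the OWNER's `…CompactFibreLCS`; the refuter's β-ne7bref-g69-1 shift and ϝ-ne7bref-g70-1 display)

Cell `pub-balaban`, sub-cell `t4`, spine estimate NE7b (`T4WeightBudget.RelWeightBound` — the cell's OWN estimate, NOT PRINTED in
[Bałaban 1983–89], NOT PROVED).  Crux-route MODEL work under `Spine/NE7b/`; no `T4Continuum/Support` leaf, no `def`, nothing of Bałaban's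
named or asserted; 0 `sorry`.

WHAT.  First the SALE made explicit (the refuter's shift β-ne7bref-g69-1 and located ϝ-ne7bref-g70-1: «the level-matching ∕
relative-floor letter is NE7b's SALE, not bookkeeping»): if on the numerator's support the interaction exceeds the fibrewise level
`m₀(y)` by at least a FLOOR `a` (`m₀ y + a ≤ I(x,y)` — «a large-field core plaquette at far-small data raises the Dirichlet minimum by
≥ a») while the denominator's mass letter is written at the level `m₀` itself, the floor is SUBTRACTED in the exponent:
`∫F·w·e^{−I} ≤ e^{i₀ − a}·(∫F dκ ∕ γ)·∫G·w·e^{−I}` (`relFibre_moment_le_of_floor`; centred-window carrier form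
`relCarrier_le_of_centredWindow_floor` with price `e^{i₀ − a + b_vol}`).  Then the junction, per pattern prefix `g` of a level `j < K`
and background `y`: near fibre `Kf j g` a measurable GROUP with a left-invariant s-finite
`κ j g` (Haar on the pinned region's bond variables), far space `Yf j g` with `ν j g`, data `F, G, w, I` and a level `m`, a centre `U₀`
depending on `(j, g, y)`, and `y`-UNIFORM letters: ONE window `W j g ⊆ Kf j g` of positive mass, the relative excess `i₀ j g`, the volume
letter `bvol j g` (`∫F dκ ∕ κ(W) ≤ e^{b_vol}`), the FLOOR `a j g` (take `a = 0` for none).  ON THE SUPPORT OF THE TERM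
(`eterm j g y ≠ 0`) the hypotheses of `…CompactFibreRelative.relFibre_moment_le_of_centredWindow` at the level `m₀` with the floor on
the numerator's support ⟹ **`LocCondStability T S K μ ρ₀ M (i₀ − a + b_vol)`**, integrability conjunct included
(`locCondStability_of_relCompactCarrier_on_support`; plumbing over `relCarrier_nonneg` ∕ `relCarrier_le_of_centredWindow_floor` and
the OWNER's `locCondStability_of_carrier_le_on_support`).  The DISPLAY of `a` with its printed source (threshold nesting,
[Balaban1989LargeFieldI] §1 ∕ [Balaban1989LargeFieldII] (1.3)) is the instance's — the refuter's Q-ne7bref-g70-2.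

NOT HERE (honest): that Bałaban's creation-level ∕ 𝐑-quotient kernels ARE of this form ((A3)); the letters by value; the denominator's
positivity where the instance identifies `M` with the ratio (Lean's `x ∕ 0 = 0`); anything of Bałaban's.  BY-NAME EFFECT ON THE WALL:
NONE.  NE7b NOT PRINTED ∕ NOT PROVED; spine PROVED 0∕9; rung (B)+1 on a FINITE torus — NOT infinite volume, NOT the mass gap, NOT Clay.
HONEST DEPENDENCY: continuum YM on T⁴ ⇐ BetaPertH ∧ nine spine estimates (0/9 proved); BetaPertH ⇐ (D1) ∧ (D4) ∧ CAP+tail;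
G-an2-4 gates asym, D1 and NE2/3/4.
-/

set_option autoImplicit false

open MeasureTheory Real Finset
open Summit.QuantumFields.BalabanUV.T4Continuum.B16HistoryIndexedRepr Summit.QuantumFields.BalabanUV.T4Continuum.B16HistoryReprChain
open Summit.QuantumFields.BalabanUV.T4Continuum.NE7b.PrefixExtraction Summit.QuantumFields.BalabanUV.T4Continuum.NE7b.LocalConditionalStability
open Summit.QuantumFields.BalabanUV.T4Continuum.NE7b.CarrierOnSupport
open Summit.QuantumFields.BalabanUV.T4Continuum.NE7b.CompactFibreRelative

namespace Summit.QuantumFields.BalabanUV.T4Continuum.NE7b.CompactFibreRelativeLCS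

/-! ## §1 The large-field FLOOR is subtracted in the exponent -/

section Floor

variable {K Y : Type*} [MeasurableSpace K] [MeasurableSpace Y] (κ : Measure K) (μ : Measure Y) [SFinite κ] [SFinite μ]

/-- **THE FLOOR IS SUBTRACTED** (abstract fibre): numerator support floor `m₀ y + a ≤ I(x,y)`, denominator mass letter at the level
`m₀` with excess `i₀` ⊢ `∫F·w·e^{−I} ≤ e^{i₀ − a}·(∫F dκ ∕ γ)·∫G·w·e^{−I}` (`relFibre_moment_le` at the level `m₀ + a`). [folklore] -/
theorem relFibre_moment_le_of_floor (F G : K → ℝ) (w : Y → ℝ) (I : K × Y → ℝ) (m₀ : Y → ℝ) {a i₀ γ : ℝ}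
    (hF0 : ∀ x, 0 ≤ F x) (hw0 : ∀ y, 0 ≤ w y) (hγ : 0 < γ)
    (hfloor : ∀ x y, F x ≠ 0 → w y ≠ 0 → m₀ y + a ≤ I (x, y))
    (hden : ∀ y, w y ≠ 0 → γ * exp (-(m₀ y + i₀)) ≤ ∫ x, G x * exp (-I (x, y)) ∂κ)
    (hF : Integrable F κ)
    (hA' : Integrable (fun z : K × Y => F z.1 * w z.2 * exp (-I z)) (κ.prod μ))
    (hB' : Integrable (fun z : K × Y => G z.1 * w z.2 * exp (-I z)) (κ.prod μ)) :
    ∫ z, F z.1 * w z.2 * exp (-I z) ∂(κ.prod μ) ≤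
      (exp (i₀ - a) * ((∫ x, F x ∂κ) / γ)) * ∫ z, G z.1 * w z.2 * exp (-I z) ∂(κ.prod μ) :=
  relFibre_moment_le κ μ F G w I (fun y => m₀ y + a) hF0 hw0 hγ hfloor (fun y hy => by
    have e : m₀ y + a + (i₀ - a) = m₀ y + i₀ := by ring
    rw [e]; exact hden y hy) hF hA' hB'

variable [Group K] [MeasurableMul K] [κ.IsMulLeftInvariant]

/-- **CARRIER FORM, CENTRED WINDOWS, WITH THE FLOOR**: the relative excess `hIrel` and the floor `hfloor` are both written against
the SAME fibrewise level `m₀(y)`; the conditional moment of one background is at most `e^{i₀ − a + b_vol}`. [folklore] -/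
theorem relCarrier_le_of_centredWindow_floor (F G : K → ℝ) (w : Y → ℝ) (I : K × Y → ℝ) (m₀ : Y → ℝ) (U₀ : Y → K)
    (W : Set K) {a i₀ bvol : ℝ} (hF0 : ∀ x, 0 ≤ F x) (hG0 : ∀ x, 0 ≤ G x) (hw0 : ∀ y, 0 ≤ w y)
    (hW : MeasurableSet W) (hWpos : 0 < κ.real W)
    (hfloor : ∀ x y, F x ≠ 0 → w y ≠ 0 → m₀ y + a ≤ I (x, y))
    (hGwin : ∀ y v, w y ≠ 0 → v ∈ W → 1 ≤ G (U₀ y * v))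
    (hIrel : ∀ y v, w y ≠ 0 → v ∈ W → I (U₀ y * v, y) ≤ m₀ y + i₀)
    (hfrac : (∫ x, F x ∂κ) / κ.real W ≤ exp bvol)
    (hF : Integrable F κ) (hGI : ∀ y, w y ≠ 0 → Integrable (fun x => G x * exp (-I (x, y))) κ)
    (hA' : Integrable (fun z : K × Y => F z.1 * w z.2 * exp (-I z)) (κ.prod μ))
    (hB' : Integrable (fun z : K × Y => G z.1 * w z.2 * exp (-I z)) (κ.prod μ)) :
    (∫ z, F z.1 * w z.2 * exp (-I z) ∂(κ.prod μ)) / (∫ z, G z.1 * w z.2 * exp (-I z) ∂(κ.prod μ)) ≤ exp (i₀ - a + bvol) :=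
  relCarrier_le_of_centredWindow κ μ F G w I (fun y => m₀ y + a) U₀ W hF0 hG0 hw0 hW hWpos hfloor hGwin
    (fun y v hy hv => by
      have e : m₀ y + a + (i₀ - a) = m₀ y + i₀ := by ring
      rw [e]; exact hIrel y v hy hv) hfrac hF hGI hA' hB'

end Floor

/-! ## §2 The junction: `LocCondStability` by name for the fibrewise-relative compact-fibre carrier, floor displayed -/

section Junction

variable {P : Type} [DecidableEq P] {C : ℕ → Type} {𝒢 : (j : ℕ) → GoodClass (C j)}

/-- **LCS FOR A BACKGROUND-DEPENDENT FIBREWISE-RELATIVE COMPACT-FIBRE CARRIER, ON THE SUPPORT.**  At every pattern prefix `g` of a level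
`j < K` and every background `y` let `M j g y` be the conditional moment `(∫F·w·e^{−I}) ∕ (∫G·w·e^{−I})` of the data at `(j, g, y)` over
`(κ j g).prod (ν j g)` — near fibre `Kf j g` a measurable group with a LEFT-INVARIANT s-finite `κ j g`, far space `Yf j g` —; suppose
`M j g` is a.e.-strongly measurable and ON THE SUPPORT OF THE TERM the hypotheses of
`…CompactFibreRelative.relFibre_moment_le_of_centredWindow` hold: `F, G, w ≥ 0`, a fibrewise level `m` below the interaction on the
numerator's support raised by the `y`-UNIFORM FLOOR `a j g` (`hfloor : m + a ≤ I` — the large-field sale; `a = 0` for none), a centre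
`U₀` with the denominator factor dominating the centred window (`hGwin`) and the relative excess there at most the `y`-UNIFORM `i₀ j g`
(`hIrel : I ≤ m + i₀`), ONE measurable window `W j g` of positive `κ`-mass, the volume letter `∫F dκ ∕ κ(W j g) ≤ e^{bvol j g}`,
integrabilities.  Then `LocCondStability T S K μ ρ₀ M (i₀ − a + b_vol)`. [folklore] -/
theorem locCondStability_of_relCompactCarrier_on_support (T : Tower P C 𝒢) (Spat : (j : ℕ) → (Fin j → P) → Finset P)
    (K : ℕ) [∀ j, MeasurableSpace (C j)] (μ : (j : ℕ) → Measure (C j)) (ρ₀ : C 0 → ℝ)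
    (M : (j : ℕ) → (Fin j → P) → C j → ℝ)
    (Kf Yf : (j : ℕ) → (Fin j → P) → Type) [∀ j g, MeasurableSpace (Kf j g)] [∀ j g, MeasurableSpace (Yf j g)]
    [∀ j g, Group (Kf j g)] [∀ j g, MeasurableMul (Kf j g)]
    (κ : (j : ℕ) → (g : Fin j → P) → Measure (Kf j g)) (ν : (j : ℕ) → (g : Fin j → P) → Measure (Yf j g))
    [∀ j g, SFinite (κ j g)] [∀ j g, SFinite (ν j g)] [∀ j g, (κ j g).IsMulLeftInvariant]
    (F G : (j : ℕ) → (g : Fin j → P) → C j → Kf j g → ℝ) (w : (j : ℕ) → (g : Fin j → P) → C j → Yf j g → ℝ)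
    (I : (j : ℕ) → (g : Fin j → P) → C j → Kf j g × Yf j g → ℝ)
    (m : (j : ℕ) → (g : Fin j → P) → C j → Yf j g → ℝ) (U₀ : (j : ℕ) → (g : Fin j → P) → C j → Yf j g → Kf j g)
    (W : (j : ℕ) → (g : Fin j → P) → Set (Kf j g)) (i₀ a bvol : (j : ℕ) → (Fin j → P) → ℝ)
    (hρ : (𝒢 0).Gd ρ₀) (h0 : ∀ x, 0 ≤ ρ₀ x)
    (hM : ∀ j g, j < K → g ∈ admS T Spat j → ∀ y, M j g y =
      (∫ z, F j g y z.1 * w j g y z.2 * exp (-I j g y z) ∂((κ j g).prod (ν j g))) /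
        ∫ z, G j g y z.1 * w j g y z.2 * exp (-I j g y z) ∂((κ j g).prod (ν j g)))
    (hMm : ∀ j g, j < K → g ∈ admS T Spat j → AEStronglyMeasurable (M j g) (μ j))
    (hF0 : ∀ j g, j < K → g ∈ admS T Spat j → ∀ y x, 0 ≤ F j g y x)
    (hG0 : ∀ j g, j < K → g ∈ admS T Spat j → ∀ y x, 0 ≤ G j g y x)
    (hw0 : ∀ j g, j < K → g ∈ admS T Spat j → ∀ y x, 0 ≤ w j g y x)
    (hW : ∀ j g, j < K → g ∈ admS T Spat j → MeasurableSet (W j g))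
    (hWpos : ∀ j g, j < K → g ∈ admS T Spat j → 0 < (κ j g).real (W j g))
    (hfloor : ∀ j g, j < K → g ∈ admS T Spat j → ∀ y, T.eterm ρ₀ j g y ≠ 0 → ∀ x v,
      F j g y x ≠ 0 → w j g y v ≠ 0 → m j g y v + a j g ≤ I j g y (x, v))
    (hGwin : ∀ j g, j < K → g ∈ admS T Spat j → ∀ y, T.eterm ρ₀ j g y ≠ 0 → ∀ v u,
      w j g y v ≠ 0 → u ∈ W j g → 1 ≤ G j g y (U₀ j g y v * u))
    (hIrel : ∀ j g, j < K → g ∈ admS T Spat j → ∀ y, T.eterm ρ₀ j g y ≠ 0 → ∀ v u,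
      w j g y v ≠ 0 → u ∈ W j g → I j g y (U₀ j g y v * u, v) ≤ m j g y v + i₀ j g)
    (hfrac : ∀ j g, j < K → g ∈ admS T Spat j → ∀ y, T.eterm ρ₀ j g y ≠ 0 →
      (∫ x, F j g y x ∂κ j g) / (κ j g).real (W j g) ≤ exp (bvol j g))
    (hF : ∀ j g, j < K → g ∈ admS T Spat j → ∀ y, T.eterm ρ₀ j g y ≠ 0 → Integrable (F j g y) (κ j g))
    (hGI : ∀ j g, j < K → g ∈ admS T Spat j → ∀ y, T.eterm ρ₀ j g y ≠ 0 → ∀ v, w j g y v ≠ 0 →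
      Integrable (fun x => G j g y x * exp (-I j g y (x, v))) (κ j g))
    (hA' : ∀ j g, j < K → g ∈ admS T Spat j → ∀ y, T.eterm ρ₀ j g y ≠ 0 →
      Integrable (fun z : Kf j g × Yf j g => F j g y z.1 * w j g y z.2 * exp (-I j g y z)) ((κ j g).prod (ν j g)))
    (hB' : ∀ j g, j < K → g ∈ admS T Spat j → ∀ y, T.eterm ρ₀ j g y ≠ 0 →
      Integrable (fun z : Kf j g × Yf j g => G j g y z.1 * w j g y z.2 * exp (-I j g y z)) ((κ j g).prod (ν j g)))
    (hint : ∀ j g, j < K → g ∈ admS T Spat j → Integrable (T.eterm ρ₀ j g) (μ j)) :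
    LocCondStability T Spat K μ ρ₀ M (fun j g => i₀ j g - a j g + bvol j g) := by
  refine locCondStability_of_carrier_le_on_support T Spat K μ ρ₀ M _ hρ h0 hMm (fun j g hj hg y => ?_)
    (fun j g hj hg y hy => ?_) hint
  · rw [hM j g hj hg y]
    exact relCarrier_nonneg _ _ _ _ _ _ (hF0 j g hj hg y) (hG0 j g hj hg y) (hw0 j g hj hg y)
  · rw [hM j g hj hg y]
    exact relCarrier_le_of_centredWindow_floor _ _ _ _ _ _ (m j g y) (U₀ j g y) (W j g) (hF0 j g hj hg y) (hG0 j g hj hg y)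
      (hw0 j g hj hg y) (hW j g hj hg) (hWpos j g hj hg) (hfloor j g hj hg y hy) (hGwin j g hj hg y hy) (hIrel j g hj hg y hy)
      (hfrac j g hj hg y hy) (hF j g hj hg y hy) (hGI j g hj hg y hy) (hA' j g hj hg y hy) (hB' j g hj hg y hy)

end Junction

end Summit.QuantumFields.BalabanUV.T4Continuum.NE7b.CompactFibreRelativeLCS
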